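import Mathlib
import Summits.Ventures.PercRepro2.Defs
import Summits.Ventures.PercRepro2.Graph
import Summits.Ventures.PercRepro2.OneColourSwitch
import Summits.Ventures.PercRepro2.RegionHubSign
import Summits.Ventures.PercRepro2.SideSwitch
import Summits.Ventures.PercRepro2.SideSwitchFibre
import Summits.Ventures.PercRepro2.SideSwitchComps
import Summits.Ventures.PercRepro2.M9NoPocketDefs
import Summits.Ventures.PercRepro2.M9NoPocketWorld
import Summits.Ventures.PercRepro2.M9NoPocketWorldD
import Summits.Ventures.PercRepro2.M9NoPocketCompl
import Summits.Ventures.PercRepro2.M9NoPocketFreeBlock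
import Summits.Ventures.PercRepro2.M9NoPocketFreeBlockK

/-!
# The same-type representatives of the no-pocket fibration (blind cell PercRepro2, p3 g36,
2026-08-29; `proofs/P3-NPHDR.md` §5, the unit coordinates)

On the class `{NoPocketAt d, T-free, no loop at d}` every edge at `d` goes into a block of
`G − d` (`exists_block_of_edge_at_d`).  A representative is SAME-TYPE when every edge at `d`
is `Y`; every representative is a dead pattern `flipF D ρ₀` of a unique same-type `ρ₀` with
`D` its `W` edges at `d`, so a sum over the representatives is a double sum over the same-type
ones and the subsets of the edges at `d` (`sum_repD_eq_sum_sameType_powerset`).  The legal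
vectors of a same-type representative are all the block subsets (`mem_L4_sameType_iff`), `d` is
`Y`-reached exactly when some joined block is unswitched (`d_mem_K2_assignX_sameType_iff`),
and in general exactly when it has a `Y`-source (`d_mem_K2_assignX_iff_srcY`).  The outside
flip preserves the same-type representatives and commutes with the dead patterns
(`flipOp_sameType`, `flipOp_flipF`).  The dead patterns themselves are `M9NoPocketDeadPattern`.
Own work; std axioms.
-/

namespace Summit.Ventures.PercRepro2

namespace NoPocket

open Finset Classical RegionHub OneColourSwitch SideSwitch

variable {V : Type*} {E : Type*}

section SameType

variable [Fintype V] [DecidableEq V] [Fintype E] [DecidableEq E] {ends : E → Sym2 V}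

omit [DecidableEq E] in
/-- On the `T`-free class without a loop at `d`, every edge at `d` goes into a block. -/
lemma exists_block_of_edge_at_d {d r s : V} (hnp : NoPocketAt ends d r s) (hr : d ≠ r)
    (hs : d ≠ s) (hT : Tset ends d r s = ∅) (hloop : ∀ e, ends e ≠ s(d, d)) (ρ : Config E)
    {e : E} (he : d ∈ ends e) :
    ∃ C ∈ blocks ends d r s ρ, ∃ y ∈ C, ends e = s(d, y) := by
  obtain ⟨y, hy⟩ := Sym2.mem_iff_exists.1 he
  have hyd : y ≠ d := by
    rintro rfl
    exact hloop e hy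
  have hyr : y ≠ r := by
    intro hyr
    have h : e ∈ Tset ends d r s := mem_Tset.2 (Or.inl (by rw [hy, hyr]))
    rw [hT] at h
    exact Finset.notMem_empty e h
  have hys : y ≠ s := by
    intro hys
    have h : e ∈ Tset ends d r s := mem_Tset.2 (Or.inr (by rw [hy, hys]))
    rw [hT] at h
    exact Finset.notMem_empty e h
  have hw := neighbour_mem_worlds hnp hr hs ρ hy hyd hyr hys
  have hyA : y ∈ A0 (endsD ends d) r s ρ := mem_A0.2 ⟨hw, hyr, hys⟩
  obtain ⟨hC, hyC⟩ := block_of_mem_A0 (ends := ends) (r := r) (s := s) (ρ := ρ) hyA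
  exact ⟨_, hC, y, hyC, hy⟩

omit [Fintype V] [DecidableEq V] [Fintype E] [DecidableEq E] in
/-- A same-type representative has no dead edge. -/
lemma not_hasW_of_sameType {d : V} {ρ : Config E} (hst : ∀ e, d ∈ ends e → ρ e = true)
    (C : Finset V) : ¬ hasW ends d ρ C := by
  rintro ⟨e, y, _, hends, hρe⟩
  have := hst e (by rw [hends]; exact Sym2.mem_mk_left _ _)
  rw [this] at hρe
  exact Bool.noConfusion hρe

omit [Fintype V] [DecidableEq V] [Fintype E] [DecidableEq E] in
/-- In a same-type representative a block is joined exactly when some edge of `d` enters it. -/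
lemma hasY_sameType_iff {d : V} {ρ : Config E} (hst : ∀ e, d ∈ ends e → ρ e = true)
    (C : Finset V) : hasY ends d ρ C ↔ ∃ e, ∃ y ∈ C, ends e = s(d, y) := by
  constructor
  · rintro ⟨e, y, hy, hends, _⟩
    exact ⟨e, y, hy, hends⟩
  · rintro ⟨e, y, hy, hends⟩
    exact ⟨e, y, hy, hends, hst e (by rw [hends]; exact Sym2.mem_mk_left _ _)⟩

omit [Fintype V] [DecidableEq V] [Fintype E] [DecidableEq E] in
/-- In a same-type representative a block is free exactly when it is not joined. -/
lemma free_iff_not_hasY_sameType {d : V} {ρ : Config E} (hst : ∀ e, d ∈ ends e → ρ e = true)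
    (C : Finset V) : Free ends d C ↔ ¬ hasY ends d ρ C := by
  rw [hasY_sameType_iff hst]
  constructor
  · rintro hfree ⟨e, y, hy, hends⟩
    exact hfree e y hy hends
  · intro h e y hy hends
    exact h ⟨e, y, hy, hends⟩

omit [Fintype V] [DecidableEq E] in
/-- The dead edges of a representative at `d` are at `d`. -/
lemma wEdges_at_d {d : V} (ρ : Config E) :
    ∀ e ∈ (univ.filter (fun e => d ∈ ends e)).filter (fun e => ρ e = false), d ∈ ends e :=
  fun _ he => (Finset.mem_filter.1 (Finset.mem_filter.1 he).1).2

omit [Fintype V] in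
/-- Flipping the dead edges of a representative gives a same-type colouring. -/
lemma flipF_wEdges_sameType {d : V} (ρ : Config E) :
    ∀ e, d ∈ ends e →
      flipF ((univ.filter (fun e => d ∈ ends e)).filter (fun e => ρ e = false)) ρ e = true := by
  intro e he
  by_cases hρe : ρ e = false
  · have hmem : e ∈ (univ.filter (fun e => d ∈ ends e)).filter (fun e => ρ e = false) :=
      Finset.mem_filter.2 ⟨Finset.mem_filter.2 ⟨Finset.mem_univ _, he⟩, hρe⟩
    rw [flipF_of_mem hmem, hρe]
    rfl
  · have hnot : e ∉ (univ.filter (fun e => d ∈ ends e)).filter (fun e => ρ e = false) :=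
      fun h => hρe (Finset.mem_filter.1 h).2
    rw [flipF_of_notMem hnot]
    cases h : ρ e
    · exact absurd h hρe
    · rfl

omit [Fintype V] in
/-- The dead edges of a dead pattern of a same-type colouring are the pattern. -/
lemma wEdges_flipF_sameType {d : V} {ρ₀ : Config E} (hst : ∀ e, d ∈ ends e → ρ₀ e = true)
    {D : Finset E} (hD : D ⊆ univ.filter (fun e => d ∈ ends e)) :
    (univ.filter (fun e => d ∈ ends e)).filter (fun e => flipF D ρ₀ e = false) = D := by
  ext e
  simp only [Finset.mem_filter, Finset.mem_univ, true_and]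
  constructor
  · rintro ⟨he, hf⟩
    by_contra heD
    rw [flipF_of_notMem heD, hst e he] at hf
    exact Bool.noConfusion hf
  · intro heD
    have he : d ∈ ends e := (Finset.mem_filter.1 (hD heD)).2
    refine ⟨he, ?_⟩
    rw [flipF_of_mem heD, hst e he]
    rfl

/-- **The representatives are the dead patterns of the same-type ones**: a sum over the
representatives is a double sum over the same-type representatives and the subsets of the
edges at `d`. -/
theorem sum_repD_eq_sum_sameType_powerset {p q r s d : V} (hT : Tset ends d r s = ∅)
    (g : Config E → ℤ) :
    ∑ ρ ∈ RepD ends p q r s d, g ρ =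
      ∑ ρ₀ ∈ (RepD ends p q r s d).filter (fun ρ => ∀ e, d ∈ ends e → ρ e = true),
        ∑ D ∈ (univ.filter (fun e => d ∈ ends e)).powerset, g (flipF D ρ₀) := by
  rw [← Finset.sum_product']
  refine Finset.sum_nbij'
    (fun ρ => (flipF ((univ.filter (fun e => d ∈ ends e)).filter (fun e => ρ e = false)) ρ,
      (univ.filter (fun e => d ∈ ends e)).filter (fun e => ρ e = false)))
    (fun x => flipF x.2 x.1) ?_ ?_ ?_ ?_ ?_
  · intro ρ hρ
    rw [Finset.mem_product]
    refine ⟨Finset.mem_filter.2 ⟨flipF_mem_RepD hρ hT (wEdges_at_d ρ), flipF_wEdges_sameType ρ⟩,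
      Finset.mem_powerset.2 (Finset.filter_subset _ _)⟩
  · rintro ⟨ρ₀, D⟩ hx
    rw [Finset.mem_product] at hx
    obtain ⟨hρ₀, hD⟩ := hx
    exact flipF_mem_RepD (Finset.mem_filter.1 hρ₀).1 hT
      (fun e he => (Finset.mem_filter.1 (Finset.mem_powerset.1 hD he)).2)
  · intro ρ _
    exact flipF_flipF _ _
  · rintro ⟨ρ₀, D⟩ hx
    rw [Finset.mem_product] at hx
    obtain ⟨hρ₀, hD⟩ := hx
    have hst := (Finset.mem_filter.1 hρ₀).2
    have hW := wEdges_flipF_sameType hst (Finset.mem_powerset.1 hD)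
    simp only [hW, flipF_flipF]
  · intro ρ _
    simp only [flipF_flipF]

omit [DecidableEq E] in
/-- The legal vectors of a same-type representative: every block subset, no `T`-edge. -/
lemma mem_L4_sameType_iff {d r s : V} (hT : Tset ends d r s = ∅) {ρ₀ : Config E}
    (hst : ∀ e, d ∈ ends e → ρ₀ e = true) {x : Finset (Finset V) × Finset E} :
    x ∈ L4 ends d r s ρ₀ ↔ x.1 ⊆ blocks ends d r s ρ₀ ∧ x.2 = ∅ := by
  rw [mem_L4]
  constructor
  · rintro ⟨⟨hT1, hF⟩, _, _⟩
    rw [hT] at hF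
    exact ⟨hT1, Finset.subset_empty.1 hF⟩
  · rintro ⟨hT1, hF⟩
    refine ⟨⟨hT1, by rw [hF]; exact Finset.empty_subset _⟩, ?_, ?_⟩
    · intro _ C _ _
      exact not_hasW_of_sameType hst C
    · intro _ C _
      exact not_hasW_of_sameType hst C

omit [DecidableEq E] in
/-- A sum over the legal vectors of a same-type representative is a sum over the block
subsets. -/
lemma sum_L4_sameType {d r s : V} (hT : Tset ends d r s = ∅) {ρ₀ : Config E}
    (hst : ∀ e, d ∈ ends e → ρ₀ e = true) (f : Finset (Finset V) × Finset E → ℤ) :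
    ∑ x ∈ L4 ends d r s ρ₀, f x = ∑ X ∈ (blocks ends d r s ρ₀).powerset, f (X, ∅) := by
  refine Finset.sum_nbij' (fun x => x.1) (fun X => (X, ∅)) ?_ ?_ ?_ ?_ ?_
  · intro x hx
    exact Finset.mem_powerset.2 ((mem_L4_sameType_iff hT hst).1 hx).1
  · intro X hX
    exact (mem_L4_sameType_iff hT hst).2 ⟨Finset.mem_powerset.1 hX, rfl⟩
  · intro x hx
    have h := ((mem_L4_sameType_iff hT hst).1 hx).2
    exact Prod.ext rfl h.symm
  · intro X _
    rfl
  · intro x hx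
    have h := ((mem_L4_sameType_iff hT hst).1 hx).2
    have : x = (x.1, ∅) := Prod.ext rfl h
    rw [← this]

/-- In a same-type representative, `d` is `Y`-reached in the assignment of `X` exactly when
some joined block is unswitched. -/
lemma d_mem_K2_assignX_sameType_iff {p q r s d : V} (hnp : NoPocketAt ends d r s) (hr : d ≠ r)
    (hs : d ≠ s) (hT : Tset ends d r s = ∅) {ρ₀ : Config E} (hρ₀ : ρ₀ ∈ RepD ends p q r s d)
    (hst : ∀ e, d ∈ ends e → ρ₀ e = true) {X : Finset (Finset V)}
    (hX : X ⊆ blocks ends d r s ρ₀) :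
    d ∈ K2 ends r s (assignX ends (X, ∅) ρ₀) ↔
      ¬ (blocks ends d r s ρ₀).filter (hasY ends d ρ₀) ⊆ X := by
  have hF : ((X, ∅) : Finset (Finset V) × Finset E).2 ⊆ Tset ends d r s :=
    Finset.empty_subset _
  rw [K2_assignX hnp hρ₀ hX hF hr hs (fun _ C _ => not_hasW_of_sameType hst C)]
  simp only [Set.mem_union, Set.mem_setOf_eq, true_and]
  constructor
  · rintro (h | h)
    · exact absurd h (not_mem_K2_endsD hr hs _)
    · rcases h with ⟨e, he, _⟩ | ⟨C, hC, hCX, hY⟩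
      · rw [hT] at he
        exact absurd he (Finset.notMem_empty e)
      · intro hsub
        exact hCX (hsub (Finset.mem_filter.2 ⟨hC, hY⟩))
  · intro h
    obtain ⟨C, hC, hCX⟩ := Finset.not_subset.1 h
    exact Or.inr (Or.inr ⟨C, (Finset.mem_filter.1 hC).1, hCX, (Finset.mem_filter.1 hC).2⟩)

/-- `d` is `Y`-reached in a legal assignment of a representative exactly when it has a
`Y`-source. -/
lemma d_mem_K2_assignX_iff_srcY {p q r s d : V} (hnp : NoPocketAt ends d r s) (hr : d ≠ r)
    (hs : d ≠ s) {ρ : Config E} (hρ : ρ ∈ RepD ends p q r s d)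
    {x : Finset (Finset V) × Finset E} (hx : x ∈ L4 ends d r s ρ) :
    d ∈ K2 ends r s (assignX ends x ρ) ↔ srcY ends d r s ρ x := by
  obtain ⟨⟨hT1, hF⟩, _, hLY⟩ := mem_L4.1 hx
  rw [K2_assignX hnp hρ hT1 hF hr hs hLY]
  simp only [Set.mem_union, Set.mem_setOf_eq, true_and]
  constructor
  · rintro (h | h)
    · exact absurd h (not_mem_K2_endsD hr hs _)
    · exact h
  · intro h
    exact Or.inr h

omit [DecidableEq E] in
/-- The outside flip does not change the edges at `d` (every edge at `d` enters a block). -/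
lemma flipOp_at_d_eq {d r s : V} (hnp : NoPocketAt ends d r s) (hr : d ≠ r) (hs : d ≠ s)
    (hT : Tset ends d r s = ∅) (hloop : ∀ e, ends e ≠ s(d, d)) (ρ : Config E) {e : E}
    (he : d ∈ ends e) : flipOp ends d r s ρ e = ρ e := by
  obtain ⟨C, hC, y, hyC, hends⟩ := exists_block_of_edge_at_d hnp hr hs hT hloop ρ he
  exact flipOp_of_notMem (block_edge_not_mem_within_Oprime hC hyC (by rw [hends, Sym2.eq_swap]))

/-- The outside flip preserves the same-type representatives. -/
lemma flipOp_sameType {p q r s d : V} (hnp : NoPocketAt ends d r s) (hr : d ≠ r) (hs : d ≠ s)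
    (hT : Tset ends d r s = ∅) (hloop : ∀ e, ends e ≠ s(d, d)) {ρ₀ : Config E}
    (hρ₀ : ρ₀ ∈ (RepD ends p q r s d).filter (fun ρ => ∀ e, d ∈ ends e → ρ e = true)) :
    flipOp ends d r s ρ₀ ∈
      (RepD ends p q r s d).filter (fun ρ => ∀ e, d ∈ ends e → ρ e = true) := by
  obtain ⟨hρ, hst⟩ := Finset.mem_filter.1 hρ₀
  refine Finset.mem_filter.2 ⟨flipOp_mem_RepD hr hs hρ, ?_⟩
  intro e he
  rw [flipOp_at_d_eq hnp hr hs hT hloop ρ₀ he]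
  exact hst e he

omit [Fintype V] [DecidableEq V] [Fintype E] in
/-- The outside flip commutes with a dead pattern. -/
lemma flipOp_flipF {d r s : V} (ρ : Config E) {D : Finset E} (hD : ∀ e ∈ D, d ∈ ends e) :
    flipOp ends d r s (flipF D ρ) = flipF D (flipOp ends d r s ρ) := by
  have hO : Oprime ends d r s (flipF D ρ) = Oprime ends d r s ρ := by
    have heq := flipF_eqOn_off_d (ends := ends) (ρ := ρ) hD
    simp only [Oprime, Oset]
    rw [K2_endsD_eq_of_eqOn heq, M2_endsD_eq_of_eqOn heq]
  funext e
  simp only [flipOp]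
  rw [hO]
  simp only [flipIn, flipF]
  split_ifs <;> simp

end SameType

end NoPocket

end Summit.Ventures.PercRepro2
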